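import Literature.Analysis.ODE.SchrodingerSturm
import Literature.Analysis.ODE.LinearSecondOrder
import Mathlib.Analysis.SpecialFunctions.Integrals.Basic
import Mathlib.Topology.UniformSpace.HeineCantor
import HarnessLib

/-!
# Solutions of `u'' = q u` on a half-line: localization, tails, Sturm windows, and shooting in a
# parameter for a bound state at the supremum of the oscillation set

Topic `Literature/Analysis/ODE` (namespace `Literature.Analysis.ODE`), continuing
`SchrodingerODE.lean` / `SchrodingerSturm.lean` (global classical solutions `IsSchrodingerSol q u`
of `u'' = q u` on `ℝ`). Here the coefficient `q` is only continuous on an open half-line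
`(r₀, ∞)` — the normal form `v = √Δ R` of a radial equation `Δ (Δ R')' = V R` whose coefficient
degenerates at the left end `r₀ = r₊` (Shlapentokh-Rothman, Comm. Math. Phys. 329 (2014), §2
(2.2), §4.2) — and the solutions are pairs `(u, u')` with `u' = du/dt`, `du'/dt = q u` on
`(r₀, ∞)` as in `LinearSecondOrder.lean`. Everything is proved (no named facts):

* `exists_isSchrodingerSol_eqOn` — **localization**: a solution on `(r₀, ∞)` agrees on every
  closed sub-half-line `[a, ∞)`, `a > r₀`, with a GLOBAL solution of `u'' = q̃ u` for the continuous
  coefficient `q̃ = q ∘ max(·, a₁)` (`r₀ < a₁ < a`), so that the whole-line toolkit applies;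
* consequences on `(r₀, ∞)`: simple zeros (`deriv_ne_zero_of_eq_zero_Ioi`), positivity
  propagation to the right where `q ≥ 0` (`pos_of_nonneg_coeff_Ici`), the **Sturm–Picone window**:
  a `C¹` test function with negative form on `[α, β] ⊂ (r₀, ∞)` forces a zero of every solution in
  `[α, β]` (`exists_zero_of_integral_neg`), in particular `q ≤ -k²` on a window of length `> π/k`
  does (`exists_zero_of_le_neg_sq`, test function `sin (π (t - α)/(β - α))`; Hartman Ch. XI,
  Thm. 6.2 / Sturm's comparison theorem);
* `decay_of_deriv_nonpos_tail` — **the subordinate tail**: if `q ≥ c > 0` and `u > 0`, `u' ≤ 0` on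
  `[S, ∞)`, then `|u|, |u'| ≤ C e^{-√c t}` for `t ≥ S + 1` (the energy `u'² - c u²` is
  nonincreasing and cannot become negative, else `u ≥ L₀ > 0` and `u'' ≥ c L₀` would make `u'`
  positive; Hartman Ch. XI §6, principal solutions, Cor. 6.4 / Exercise 6.8);
* `pos_of_flux_tendsto_zero` — **positivity from a singular left endpoint**: for
  `(P u')' = G u` with `P > 0`, `G ≥ 0` on `(r₀, ∞)`, flux `P u' → 0` at `r₀⁺` and `u > 0`
  initially, `u > 0` throughout (the maximum principle of SR §3.2–§3.3 for `Δ (Δ R')' = V R`,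
  `V ≥ 0`, at the horizon `Δ(r₊) = 0`);
* `exists_boundState_of_sup_oscillation` — **shooting in a parameter** (Hartman Ch. XI §6 with the
  continuity of solutions in parameters, Ch. V Thm. 2.1; this is the classical ODE substitute for
  the variational construction of SR §4.2, Props. 4.1–4.2): let `v(μ, ·)`, `μ ∈ [μa, μb]`, be
  solutions of `v'' = Q(μ, ·) v` on `(r₀, ∞)`, jointly continuous in `(μ, t)` together with
  `∂ₜ v`, positive on a fixed initial segment `(r₀, r₁]`, with `Q(μ, t) ≥ c > 0` for `t ≥ S`
  uniformly in `μ`; if some `v(μ, ·)` has a zero and `v(μb, ·)` has none, then at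
  `μ₀ = sup {μ : v(μ, ·) has a zero}` the solution is a **bound state**: `v(μ₀, ·) > 0` on `(r₀, ∞)`
  and `v(μ₀, ·)`, `∂ₜ v(μ₀, ·)` decay like `e^{-√c t}`.

## References

* P. Hartman, *Ordinary Differential Equations*, Classics in Applied Mathematics 38 (SIAM 2002),
  Ch. XI §6 (Thm. 6.2, Cor. 6.1, Cor. 6.4, Exercise 6.8), Ch. V Thm. 2.1. Key `Hartman2002`.
* Y. Shlapentokh-Rothman, *Exponentially growing finite energy solutions for the Klein–Gordon
  equation on sub-extremal Kerr spacetimes*, Comm. Math. Phys. 329 (2014) 859–891, §4.2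
  (existence of real mode solutions: `μ₀ = sup 𝒜`, Props. 4.1–4.2, Lemma 4.3).
  Key `ShlapentokhRothman2014KleinGordon`.
-/

noncomputable section

open Set Metric Filter MeasureTheory intervalIntegral
open scoped NNReal Topology

namespace Literature.Analysis.ODE

/-! ## Localization: half-line solutions are restrictions of global solutions -/

section Localization

variable {q u u' : ℝ → ℝ} {r₀ : ℝ}

/-- The coefficient frozen below `a₁`: `q̃ t = q (max t a₁)`, continuous on `ℝ` when `q` is
continuous on `(r₀, ∞) ∋ a₁`, and equal to `q` on `[a₁, ∞)`. [folklore] -/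
theorem continuous_comp_max (hq : ContinuousOn q (Ioi r₀)) {a₁ : ℝ} (ha₁ : r₀ < a₁) :
    Continuous fun t ↦ q (max t a₁) := by
  have hmem : ∀ t : ℝ, max t a₁ ∈ Ioi r₀ := fun t ↦ lt_of_lt_of_le ha₁ (le_max_right _ _)
  exact hq.comp_continuous (continuous_id.max continuous_const) hmem

/-- **Localization.** Let `q` be continuous on `(r₀, ∞)` and let `(u, u')` solve `du/dt = u'`,
`du'/dt = q u` there. For every `a > r₀` there are a continuous coefficient `q̃` on `ℝ`, equal to
`q` on `[a, ∞)`, and a global classical solution `ũ` of `ũ'' = q̃ ũ` with `ũ = u`, `ũ' = u'` on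
`[a, ∞)` (freeze the coefficient below some `a₁ ∈ (r₀, a)`, solve globally, and use uniqueness on
`(a₁, ∞)`, Hartman Ch. IV Lemma 1.1). [cite: Hartman2002, Ch. IV Lemma 1.1] -/
theorem exists_isSchrodingerSol_eqOn (hq : ContinuousOn q (Ioi r₀))
    (hsol : ∀ t ∈ Ioi r₀, HasDerivAt u (u' t) t ∧ HasDerivAt u' (q t * u t) t) {a : ℝ}
    (ha : r₀ < a) :
    ∃ qt ut : ℝ → ℝ, Continuous qt ∧ IsSchrodingerSol qt ut ∧ EqOn qt q (Ici a) ∧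
      EqOn ut u (Ici a) ∧ EqOn (deriv ut) u' (Ici a) := by
  obtain ⟨a₁, ha₁, ha₁a⟩ := exists_between ha
  set qt : ℝ → ℝ := fun t ↦ q (max t a₁) with hqt
  have hqtc : Continuous qt := continuous_comp_max hq ha₁
  have hqt_eq : ∀ t, a₁ ≤ t → qt t = q t := fun t ht ↦ by simp [hqt, max_eq_left ht]
  obtain ⟨ut, hut, hu0, hu1⟩ := exists_isSchrodingerSol hqtc a (u a) (u' a)
  -- uniqueness on every `(a₁, B)`
  have key : ∀ B : ℝ, a < B → EqOn ut u (Ioo a₁ B) ∧ EqOn (deriv ut) u' (Ioo a₁ B) := by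
    intro B hB
    have hp : ContinuousOn (fun _ : ℝ ↦ (0 : ℝ)) (Ioo a₁ B) := continuousOn_const
    have hq' : ContinuousOn q (Ioo a₁ B) := hq.mono fun t ht ↦ lt_trans ha₁ ht.1
    refine eqOn_of_solution_Ioo (p := fun _ ↦ (0 : ℝ)) hp hq' ⟨ha₁a, hB⟩
      (u := ut) (u' := deriv ut) (v := u) (v' := u') (fun t ht ↦ ⟨hut.hasDerivAt t, ?_⟩)
      (fun t ht ↦ ⟨(hsol t (lt_trans ha₁ ht.1)).1, ?_⟩) hu0 hu1
    · have h := hut.hasDerivAt_deriv t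
      rw [hqt_eq t ht.1.le] at h
      simpa using h
    · simpa using (hsol t (lt_trans ha₁ ht.1)).2
  refine ⟨qt, ut, hqtc, hut, fun t ht ↦ hqt_eq t (ha₁a.le.trans ht), fun t ht ↦ ?_, fun t ht ↦ ?_⟩
  · exact (key (t + 1) (by linarith [mem_Ici.1 ht])).1 ⟨lt_of_lt_of_le ha₁a ht, by linarith⟩
  · exact (key (t + 1) (by linarith [mem_Ici.1 ht])).2 ⟨lt_of_lt_of_le ha₁a ht, by linarith⟩

/-- **Simple zeros.** A solution on `(r₀, ∞)` which does not vanish identically there has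
`u' t ≠ 0` at each of its zeros `t > r₀`. [cite: Hartman2002, Ch. IV Cor. 1.1] -/
theorem deriv_ne_zero_of_eq_zero_Ioi (hq : ContinuousOn q (Ioi r₀))
    (hsol : ∀ t ∈ Ioi r₀, HasDerivAt u (u' t) t ∧ HasDerivAt u' (q t * u t) t) {s₁ : ℝ}
    (hs₁ : r₀ < s₁) (hne : u s₁ ≠ 0) {t : ℝ} (ht : r₀ < t) (hut : u t = 0) : u' t ≠ 0 := by
  obtain ⟨a, ha, ha'⟩ := exists_between (lt_min hs₁ ht)
  obtain ⟨qt, ut, hqtc, hut', -, hequ, heqd⟩ := exists_isSchrodingerSol_eqOn hq hsol ha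
  have has₁ : s₁ ∈ Ici a := (min_le_left _ _).trans' ha'.le |> mem_Ici.2
  have hat : t ∈ Ici a := (min_le_right _ _).trans' ha'.le |> mem_Ici.2
  intro h0
  have h1 : ut t = 0 := by rw [hequ hat, hut]
  have h2 : deriv ut t = 0 := by rw [heqd hat, h0]
  have h3 := hut'.eq_zero_of_eq_zero hqtc h1 h2
  exact hne (by rw [← hequ has₁, h3]; rfl)

/-- **A zero of a nontrivial solution is a sign change**: there are points `t₋ < t < t₊` in
`(r₀, ∞)`, as close to `t` as desired, with `u t₋ · u t₊ < 0`. [folklore] -/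
theorem exists_sign_change_of_eq_zero (hq : ContinuousOn q (Ioi r₀))
    (hsol : ∀ t ∈ Ioi r₀, HasDerivAt u (u' t) t ∧ HasDerivAt u' (q t * u t) t) {s₁ : ℝ}
    (hs₁ : r₀ < s₁) (hne : u s₁ ≠ 0) {t : ℝ} (ht : r₀ < t) (hut : u t = 0) {ε : ℝ} (hε : 0 < ε) :
    ∃ tm tp : ℝ, r₀ < tm ∧ tm < t ∧ t < tp ∧ t - ε < tm ∧ tp < t + ε ∧ u tm * u tp < 0 := by
  have hd : u' t ≠ 0 := deriv_ne_zero_of_eq_zero_Ioi hq hsol hs₁ hne ht hut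
  have hderiv : HasDerivAt u (u' t) t := (hsol t ht).1
  -- the difference quotient has the sign of `u' t` near `t`
  have hslope : Tendsto (fun s ↦ (u s - u t) / (s - t)) (𝓝[≠] t) (𝓝 (u' t)) := by
    have h := hderiv.tendsto_slope
    simp only [slope_fun_def_field] at h
    exact h
  have hev : ∀ᶠ s in 𝓝[≠] t, 0 < (u s - u t) / (s - t) * u' t := by
    have h2 : Tendsto (fun s ↦ (u s - u t) / (s - t) * u' t) (𝓝[≠] t) (𝓝 (u' t * u' t)) :=
      hslope.mul_const _
    exact h2.eventually (lt_mem_nhds (mul_self_pos.2 hd))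
  rw [eventually_nhdsWithin_iff, Metric.eventually_nhds_iff] at hev
  obtain ⟨δ, hδ, hδp⟩ := hev
  set η : ℝ := min (min δ ε) (t - r₀) / 2 with hη
  have hη0 : 0 < η := by
    have : 0 < min (min δ ε) (t - r₀) := lt_min (lt_min hδ hε) (by linarith)
    positivity
  have hηδ : η < δ := by
    have : min (min δ ε) (t - r₀) ≤ δ := (min_le_left _ _).trans (min_le_left _ _)
    rw [hη]; linarith
  have hηε : η < ε := by
    have : min (min δ ε) (t - r₀) ≤ ε := (min_le_left _ _).trans (min_le_right _ _)
    rw [hη]; linarith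
  have hηr : η < t - r₀ := by
    have : min (min δ ε) (t - r₀) ≤ t - r₀ := min_le_right _ _
    rw [hη]; linarith
  have hdm : dist (t - η) t < δ := by
    rw [dist_eq_norm, Real.norm_eq_abs, show t - η - t = -η by ring, abs_neg, abs_of_pos hη0]
    exact hηδ
  have hdp : dist (t + η) t < δ := by
    rw [dist_eq_norm, Real.norm_eq_abs, show t + η - t = η by ring, abs_of_pos hη0]
    exact hηδ
  have hcm : t - η ∈ ({t}ᶜ : Set ℝ) := by
    simp only [mem_compl_iff, mem_singleton_iff]; intro h; linarith
  have hcp : t + η ∈ ({t}ᶜ : Set ℝ) := by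
    simp only [mem_compl_iff, mem_singleton_iff]; intro h; linarith
  have hm := hδp hdm hcm
  have hp := hδp hdp hcp
  rw [hut, sub_zero, show t - η - t = -η by ring] at hm
  rw [hut, sub_zero, show t + η - t = η by ring] at hp
  refine ⟨t - η, t + η, by linarith, by linarith, by linarith, by linarith, by linarith, ?_⟩
  -- `u(t-η)/(-η) · u' > 0` and `u(t+η)/η · u' > 0` give opposite signs
  have h1 : u (t - η) * u' t < 0 := by
    have : u (t - η) / -η * u' t = -(u (t - η) * u' t) / η := by field_simp
    rw [this] at hm
    have h3 := (div_pos_iff_of_pos_right hη0).1 hm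
    linarith
  have h2 : 0 < u (t + η) * u' t := by
    have : u (t + η) / η * u' t = (u (t + η) * u' t) / η := by field_simp
    rw [this] at hp
    exact (div_pos_iff_of_pos_right hη0).1 hp
  -- multiply: `(u(t-η) u') (u(t+η) u') < 0`, and `u'² > 0`
  have h4 : u (t - η) * u' t * (u (t + η) * u' t) < 0 := mul_neg_of_neg_of_pos h1 h2
  have h5 : u (t - η) * u' t * (u (t + η) * u' t) = u (t - η) * u (t + η) * (u' t * u' t) := by ring
  rw [h5] at h4
  by_contra hcon
  push Not at hcon
  have : 0 ≤ u (t - η) * u (t + η) * (u' t * u' t) := mul_nonneg hcon (mul_self_nonneg _)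
  linarith

/-- **Positivity propagation to the right on a half-line**: if `q ≥ 0` on `[s₀, ∞)` (`s₀ > r₀`),
`u s₀ > 0` and `u' s₀ ≥ 0`, then `u > 0` on `[s₀, ∞)`.
[cite: Hartman2002, Ch. XI Cor. 6.4 (proof)] -/
theorem pos_of_nonneg_coeff_Ici (hq : ContinuousOn q (Ioi r₀))
    (hsol : ∀ t ∈ Ioi r₀, HasDerivAt u (u' t) t ∧ HasDerivAt u' (q t * u t) t) {s₀ : ℝ}
    (hs₀ : r₀ < s₀) (hq0 : ∀ s ∈ Ici s₀, 0 ≤ q s) (h0 : 0 < u s₀) (h1 : 0 ≤ u' s₀) :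
    ∀ s ∈ Ici s₀, 0 < u s := by
  intro s hs
  obtain ⟨qt, ut, -, hut, heqq, hequ, heqd⟩ := exists_isSchrodingerSol_eqOn hq hsol hs₀
  have h := hut.pos_of_nonneg_coeff (s₀ := s₀) (T := s)
    (fun τ hτ ↦ by rw [heqq (mem_Ici.2 hτ.1)]; exact hq0 τ (mem_Ici.2 hτ.1))
    (by rw [hequ (mem_Ici.2 le_rfl)]; exact h0) (by rw [heqd (mem_Ici.2 le_rfl)]; exact h1)
    s ⟨mem_Ici.1 hs, le_rfl⟩
  rwa [hequ hs] at h

/-- **Sturm–Picone window.** If some `φ`, `C¹` on `[α, β] ⊂ (r₀, ∞)` with `φ α = φ β = 0`, makes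
the form `∫_α^β (φ'² + q φ²)` negative, then every solution on `(r₀, ∞)` has a zero in `[α, β]`
(the equation is not disconjugate on `[α, β]`: by the Picone identity applied to `u` and to `-u`,
`u` takes a value `≤ 0` and a value `≥ 0` on `[α, β]`). [cite: Hartman2002, Ch. XI Thm. 6.2 and Cor. 6.1] -/
theorem exists_zero_of_integral_neg (hq : ContinuousOn q (Ioi r₀))
    (hsol : ∀ t ∈ Ioi r₀, HasDerivAt u (u' t) t ∧ HasDerivAt u' (q t * u t) t) {α β : ℝ}
    (hα : r₀ < α) (hαβ : α ≤ β) {φ φ' : ℝ → ℝ} (hφ : ∀ s ∈ Icc α β, HasDerivAt φ (φ' s) s)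
    (hφ' : ContinuousOn φ' (Icc α β)) (ha : φ α = 0) (hb : φ β = 0)
    (hneg : ∫ s in α..β, (φ' s ^ 2 + q s * φ s ^ 2) < 0) : ∃ z ∈ Icc α β, u z = 0 := by
  obtain ⟨qt, ut, hqtc, hut, heqq, hequ, -⟩ := exists_isSchrodingerSol_eqOn hq hsol hα
  have hneg' : ∫ s in α..β, (φ' s ^ 2 + qt s * φ s ^ 2) < 0 := by
    have : ∫ s in α..β, (φ' s ^ 2 + qt s * φ s ^ 2) = ∫ s in α..β, (φ' s ^ 2 + q s * φ s ^ 2) := by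
      refine integral_congr fun s hs ↦ ?_
      rw [uIcc_of_le hαβ] at hs
      simp only [heqq (mem_Ici.2 hs.1)]
    rwa [this]
  obtain ⟨s₁, hs₁, h₁⟩ := hut.exists_nonpos_of_integral_neg hqtc hαβ hφ hφ' ha hb hneg'
  obtain ⟨s₂, hs₂, h₂⟩ := hut.neg.exists_nonpos_of_integral_neg hqtc hαβ hφ hφ' ha hb hneg'
  have h₂' : 0 ≤ ut s₂ := by linarith
  -- intermediate value theorem between `s₁` and `s₂`
  have hcont : ContinuousOn ut (uIcc s₁ s₂) := hut.continuous.continuousOn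
  have hsub : uIcc s₁ s₂ ⊆ Icc α β := uIcc_subset_Icc hs₁ hs₂
  have h0mem : (0 : ℝ) ∈ uIcc (ut s₁) (ut s₂) := by
    rw [mem_uIcc]; exact Or.inl ⟨h₁, h₂'⟩
  obtain ⟨z, hz, hz0⟩ := intermediate_value_uIcc hcont h0mem
  refine ⟨z, hsub hz, ?_⟩
  rw [← hequ (mem_Ici.2 (hsub hz).1)]
  exact hz0

/-- **Sturm's oscillation window** (comparison with a negative constant coefficient): if
`q ≤ -k²` on `[α, β] ⊂ (r₀, ∞)` with `k² (β - α)² > 10`, every solution on `(r₀, ∞)` has a zero in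
`[α, β]` (test function `φ = (t - α)(β - t)`: `∫ φ'² = (β-α)³/3`, `∫ φ² = (β-α)⁵/30`; the sharp
constant `π²` of Sturm's comparison theorem is replaced by `10`).
[cite: Hartman2002, Ch. XI Thm. 6.2 (Sturm comparison, §3)] -/
theorem exists_zero_of_le_neg_sq (hq : ContinuousOn q (Ioi r₀))
    (hsol : ∀ t ∈ Ioi r₀, HasDerivAt u (u' t) t ∧ HasDerivAt u' (q t * u t) t) {α β k : ℝ}
    (hα : r₀ < α) (hαβ : α < β) (hqk : ∀ s ∈ Icc α β, q s ≤ -k ^ 2)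
    (hk : 10 < k ^ 2 * (β - α) ^ 2) : ∃ z ∈ Icc α β, u z = 0 := by
  set L : ℝ := β - α with hL
  have hL0 : 0 < L := sub_pos.2 hαβ
  -- the test function `φ = (t - α)(β - t)` and its derivative `φ' = (β - t) - (t - α)`
  have hφd : ∀ s ∈ Icc α β, HasDerivAt (fun t : ℝ ↦ (t - α) * (β - t)) ((β - s) - (s - α)) s :=
    fun s _ ↦ (((hasDerivAt_id' s).sub_const α).mul
      ((hasDerivAt_const s β).sub (hasDerivAt_id' s))).congr_deriv (by simp; ring)
  have hφ'c : ContinuousOn (fun t : ℝ ↦ (β - t) - (t - α)) (Icc α β) := by fun_prop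
  have ha : (fun t : ℝ ↦ (t - α) * (β - t)) α = 0 := by simp
  have hb : (fun t : ℝ ↦ (t - α) * (β - t)) β = 0 := by simp
  refine exists_zero_of_integral_neg hq hsol hα hαβ.le hφd hφ'c ha hb ?_
  -- bound the form by the explicit polynomial integrals
  have hqc : ContinuousOn q (Icc α β) := hq.mono fun s hs ↦ lt_of_lt_of_le hα hs.1
  have hi1 : IntervalIntegrable (fun s ↦ ((β - s) - (s - α)) ^ 2 + q s * ((s - α) * (β - s)) ^ 2)
      volume α β := by
    refine ContinuousOn.intervalIntegrable ?_
    rw [uIcc_of_le hαβ.le]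
    exact (Continuous.continuousOn (by fun_prop)).add (hqc.mul (Continuous.continuousOn (by fun_prop)))
  have hi2 : IntervalIntegrable (fun s ↦ ((β - s) - (s - α)) ^ 2 + -k ^ 2 * ((s - α) * (β - s)) ^ 2)
      volume α β := Continuous.intervalIntegrable (by fun_prop) _ _
  have hle : ∫ s in α..β, (((β - s) - (s - α)) ^ 2 + q s * ((s - α) * (β - s)) ^ 2) ≤
      ∫ s in α..β, (((β - s) - (s - α)) ^ 2 + -k ^ 2 * ((s - α) * (β - s)) ^ 2) := by
    refine integral_mono_on hαβ.le hi1 hi2 fun s hs ↦ ?_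
    have := hqk s hs
    have h2 : 0 ≤ ((s - α) * (β - s)) ^ 2 := sq_nonneg _
    nlinarith
  -- `∫ φ'² = L³/3`
  have hI1 : ∫ s in α..β, ((β - s) - (s - α)) ^ 2 = L ^ 3 / 3 := by
    have hF : ∀ s ∈ uIcc α β, HasDerivAt (fun t : ℝ ↦ -((β - t) - (t - α)) ^ 3 / 6)
        (((β - s) - (s - α)) ^ 2) s := fun s _ ↦
      (((((hasDerivAt_const s β).sub (hasDerivAt_id' s)).sub
        ((hasDerivAt_id' s).sub_const α)).pow 3).neg.div_const 6).congr_deriv (by simp; ring)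
    rw [integral_eq_sub_of_hasDerivAt hF (Continuous.intervalIntegrable (by fun_prop) _ _)]
    simp only [hL]
    ring
  -- `∫ φ² = L⁵/30`
  have hI2 : ∫ s in α..β, ((s - α) * (β - s)) ^ 2 = L ^ 5 / 30 := by
    have hF : ∀ s ∈ uIcc α β, HasDerivAt
        (fun t : ℝ ↦ (β - α) ^ 2 * (t - α) ^ 3 / 3 - (β - α) * (t - α) ^ 4 / 2 + (t - α) ^ 5 / 5)
        (((s - α) * (β - s)) ^ 2) s := by
      intro s _
      have h1 := ((hasDerivAt_id' s).sub_const α).pow 3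
      have h2 := ((hasDerivAt_id' s).sub_const α).pow 4
      have h3 := ((hasDerivAt_id' s).sub_const α).pow 5
      exact ((((h1.const_mul ((β - α) ^ 2)).div_const 3).sub ((h2.const_mul (β - α)).div_const 2)).add
        (h3.div_const 5)).congr_deriv (by simp; ring)
    rw [integral_eq_sub_of_hasDerivAt hF (Continuous.intervalIntegrable (by fun_prop) _ _)]
    simp only [hL]
    ring
  have hI : ∫ s in α..β, (((β - s) - (s - α)) ^ 2 + -k ^ 2 * ((s - α) * (β - s)) ^ 2) =
      L ^ 3 / 3 - k ^ 2 * (L ^ 5 / 30) := by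
    have hi3 : IntervalIntegrable (fun s ↦ ((β - s) - (s - α)) ^ 2) volume α β :=
      Continuous.intervalIntegrable (by fun_prop) _ _
    have hi4 : IntervalIntegrable (fun s ↦ -k ^ 2 * ((s - α) * (β - s)) ^ 2) volume α β :=
      Continuous.intervalIntegrable (by fun_prop) _ _
    rw [integral_add hi3 hi4, intervalIntegral.integral_const_mul, hI1, hI2]
    ring
  have hneg : L ^ 3 / 3 - k ^ 2 * (L ^ 5 / 30) < 0 := by
    have h1 : L ^ 3 / 3 - k ^ 2 * (L ^ 5 / 30) = L ^ 3 / 30 * (10 - k ^ 2 * L ^ 2) := by ring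
    rw [h1]
    exact mul_neg_of_pos_of_neg (by positivity) (by linarith)
  linarith

end Localization

/-! ## The subordinate tail: positive nonincreasing solutions decay exponentially -/

section Tail

variable {q u u' : ℝ → ℝ} {r₀ : ℝ}

/-- **Exponential decay of the subordinate solution.** Let `q ≥ c > 0` on `[S, ∞) ⊂ (r₀, ∞)` and
let `(u, u')` solve `u'' = q u` on `(r₀, ∞)` with `u > 0`, `u' ≤ 0` on `[S, ∞)`. Then
`u t ≤ u S · e^{-√c (t - S)}` for `t ≥ S` (the energy `u'² - c u²` is nonincreasing on `[S, ∞)`; if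
it were negative at some `t₀`, then `u ≥ L₀ > 0` and `u'' = q u ≥ c L₀` beyond `t₀` would force
`u' > 0`; so `u'² ≥ c u²`, i.e. `u' ≤ -√c u`) (Hartman Ch. XI §6: the principal solution at `∞`,
Cor. 6.4 and Exercise 6.8). [cite: Hartman2002, Ch. XI Cor. 6.4 and Exercise 6.8] -/
theorem le_mul_exp_of_deriv_nonpos_tail (hq : ContinuousOn q (Ioi r₀))
    (hsol : ∀ t ∈ Ioi r₀, HasDerivAt u (u' t) t ∧ HasDerivAt u' (q t * u t) t) {S c : ℝ}
    (hS : r₀ < S) (hc : 0 < c) (hqc : ∀ t ∈ Ici S, c ≤ q t) (hpos : ∀ t ∈ Ici S, 0 < u t)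
    (hder : ∀ t ∈ Ici S, u' t ≤ 0) :
    ∀ t ∈ Ici S, u t ≤ u S * Real.exp (-Real.sqrt c * (t - S)) := by
  obtain ⟨qt, ut, hqtc, hut, heqq, hequ, heqd⟩ := exists_isSchrodingerSol_eqOn hq hsol hS
  -- translate the hypotheses to the global solution
  have hqc' : ∀ t ∈ Ici S, c ≤ qt t := fun t ht ↦ by rw [heqq ht]; exact hqc t ht
  have hpos' : ∀ t ∈ Ici S, 0 < ut t := fun t ht ↦ by rw [hequ ht]; exact hpos t ht
  have hder' : ∀ t ∈ Ici S, deriv ut t ≤ 0 := fun t ht ↦ by rw [heqd ht]; exact hder t ht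
  -- the energy is nonnegative on `[S, ∞)`
  have hE : ∀ t ∈ Ici S, c * ut t ^ 2 ≤ deriv ut t ^ 2 := by
    intro t₀ ht₀
    by_contra hcon
    push Not at hcon
    set η : ℝ := c * ut t₀ ^ 2 - deriv ut t₀ ^ 2 with hη
    have hη0 : 0 < η := by rw [hη]; linarith
    -- beyond `t₀` the energy stays `≤ -η`
    have hEt : ∀ t, t₀ ≤ t → deriv ut t ^ 2 - c * ut t ^ 2 ≤ -η := by
      intro t ht
      have hanti := hut.energy_antitoneOn (c := c) (a := t₀) (b := t)
        (fun s hs ↦ (hpos' s (mem_Ici.2 ((mem_Ici.1 ht₀).trans hs.1))).le)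
        (fun s hs ↦ hder' s (mem_Ici.2 ((mem_Ici.1 ht₀).trans hs.1)))
        (fun s hs ↦ hqc' s (mem_Ici.2 ((mem_Ici.1 ht₀).trans hs.1)))
      have h := hanti (left_mem_Icc.2 ht) (right_mem_Icc.2 ht) ht
      simp only at h
      rw [hη]; linarith
    -- hence `u ≥ L₀ := √(η/c)` there
    set L₀ : ℝ := Real.sqrt (η / c) with hL₀
    have hL₀pos : 0 < L₀ := Real.sqrt_pos.2 (div_pos hη0 hc)
    have hL₀sq : L₀ ^ 2 = η / c := Real.sq_sqrt (div_pos hη0 hc).le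
    have huL : ∀ t, t₀ ≤ t → L₀ ≤ ut t := by
      intro t ht
      have h1 : η ≤ c * ut t ^ 2 := by nlinarith [hEt t ht, sq_nonneg (deriv ut t)]
      have h2 : L₀ ^ 2 ≤ ut t ^ 2 := by
        rw [hL₀sq, div_le_iff₀ hc]; linarith
      have hut0 : 0 ≤ ut t := (hpos' t (mem_Ici.2 ((mem_Ici.1 ht₀).trans ht))).le
      nlinarith [hL₀pos]
    -- and `u'' ≥ c L₀`, so `u' t ≥ u' t₀ + c L₀ (t - t₀)`
    have hgrow : ∀ t, t₀ ≤ t → deriv ut t₀ + c * L₀ * (t - t₀) ≤ deriv ut t := by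
      intro t ht
      have hmono : MonotoneOn (fun s ↦ deriv ut s - c * L₀ * s) (Icc t₀ t) := by
        refine monotoneOn_of_deriv_nonneg (convex_Icc t₀ t) ?_ ?_ fun s hs ↦ ?_
        · exact (hut.continuous_deriv.sub (continuous_const.mul continuous_id)).continuousOn
        · exact (hut.differentiable_deriv.sub
            (differentiable_const _ |>.mul differentiable_id)).differentiableOn
        · rw [interior_Icc] at hs
          have hd : HasDerivAt (fun s ↦ deriv ut s - c * L₀ * s) (qt s * ut s - c * L₀ * 1) s :=
            (hut.hasDerivAt_deriv s).sub ((hasDerivAt_id s).const_mul (c * L₀))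
          rw [hd.deriv, mul_one, sub_nonneg]
          have h1 := hqc' s (mem_Ici.2 ((mem_Ici.1 ht₀).trans hs.1.le))
          have h2 := huL s hs.1.le
          have h3 : 0 ≤ ut s := hL₀pos.le.trans h2
          calc c * L₀ ≤ c * ut s := by gcongr
            _ ≤ qt s * ut s := by gcongr
      have h := hmono (left_mem_Icc.2 ht) (right_mem_Icc.2 ht) ht
      simp only at h
      linarith
    -- at a large time this contradicts `u' ≤ 0`
    set T : ℝ := t₀ + (|deriv ut t₀| + 1) / (c * L₀) with hT
    have hcL : 0 < c * L₀ := mul_pos hc hL₀pos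
    have hT₀ : t₀ ≤ T := by
      have : 0 ≤ (|deriv ut t₀| + 1) / (c * L₀) := by positivity
      rw [hT]
      linarith
    have h1 := hgrow T hT₀
    have h2 : c * L₀ * (T - t₀) = |deriv ut t₀| + 1 := by
      rw [hT]; field_simp; ring
    rw [h2] at h1
    have h3 := hder' T (mem_Ici.2 ((mem_Ici.1 ht₀).trans hT₀))
    have h4 := neg_abs_le (deriv ut t₀)
    linarith
  -- `u' ≤ -√c u` on `[S, ∞)`
  have hineq : ∀ t ∈ Ici S, deriv ut t ≤ -Real.sqrt c * ut t := by
    intro t ht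
    have h := sqrt_mul_abs_le_abs_of_sq_le hc.le (hE t ht)
    rw [abs_of_pos (hpos' t ht), abs_of_nonpos (hder' t ht)] at h
    linarith
  intro t ht
  have key := le_mul_exp_of_deriv_le (v := ut) (κ := Real.sqrt c) (S := S) (b := t)
    (fun s _ ↦ hut.hasDerivAt s) (fun s hs ↦ hineq s (mem_Ici.2 hs.1)) t ⟨mem_Ici.1 ht, le_rfl⟩
  rwa [hequ ht, hequ (mem_Ici.2 le_rfl)] at key

/-- **Exponential decay of the subordinate solution and of its derivative**, packaged: under the
hypotheses of `le_mul_exp_of_deriv_nonpos_tail` there is `C` with `|u t|, |u' t| ≤ C e^{-√c t}` for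
`t ≥ S + 1` (`|u'(t)| ≤ u(t - 1)` by convexity and the mean value theorem).
[cite: Hartman2002, Ch. XI Cor. 6.4 and Exercise 6.8] -/
theorem decay_of_deriv_nonpos_tail (hq : ContinuousOn q (Ioi r₀))
    (hsol : ∀ t ∈ Ioi r₀, HasDerivAt u (u' t) t ∧ HasDerivAt u' (q t * u t) t) {S c : ℝ}
    (hS : r₀ < S) (hc : 0 < c) (hqc : ∀ t ∈ Ici S, c ≤ q t) (hpos : ∀ t ∈ Ici S, 0 < u t)
    (hder : ∀ t ∈ Ici S, u' t ≤ 0) :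
    ∃ C : ℝ, ∀ t : ℝ, S + 1 ≤ t →
      |u t| ≤ C * Real.exp (-(Real.sqrt c * t)) ∧ |u' t| ≤ C * Real.exp (-(Real.sqrt c * t)) := by
  have hdec := le_mul_exp_of_deriv_nonpos_tail hq hsol hS hc hqc hpos hder
  set κ : ℝ := Real.sqrt c with hκ
  refine ⟨u S * Real.exp (κ * (S + 1)), fun t ht ↦ ?_⟩
  have htS : S ≤ t := by linarith
  have huS : 0 < u S := hpos S (mem_Ici.2 le_rfl)
  have hexp : ∀ s : ℝ, S ≤ s → u S * Real.exp (-κ * (s - S)) ≤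
      u S * Real.exp (κ * (S + 1)) * Real.exp (-(κ * (s + 1))) := by
    intro s _
    rw [mul_assoc, ← Real.exp_add]
    have : -κ * (s - S) = κ * (S + 1) + -(κ * (s + 1)) := by ring
    rw [this]
  constructor
  · rw [abs_of_pos (hpos t (mem_Ici.2 htS))]
    calc u t ≤ u S * Real.exp (-κ * (t - S)) := hdec t (mem_Ici.2 htS)
      _ ≤ u S * Real.exp (κ * (S + 1)) * Real.exp (-(κ * (t + 1))) := hexp t htS
      _ ≤ u S * Real.exp (κ * (S + 1)) * Real.exp (-(κ * t)) := by
          refine mul_le_mul_of_nonneg_left (Real.exp_le_exp.2 ?_) (by positivity)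
          nlinarith [Real.sqrt_nonneg c]
  · -- `|u'(t)| ≤ u(t-1)` by the mean value theorem and the monotonicity of `u'`
    have hd : ∀ τ ∈ Icc (t - 1) (t - 1 + 1), HasDerivAt u (u' τ) τ := fun τ hτ ↦
      (hsol τ (lt_of_lt_of_le hS (by linarith [hτ.1]))).1
    have hderiv_eq : ∀ τ, r₀ < τ → deriv u τ = u' τ := fun τ hτ ↦ (hsol τ hτ).1.deriv
    have hmono : MonotoneOn u' (Icc (t - 1) (t - 1 + 1)) := by
      refine monotoneOn_of_deriv_nonneg (convex_Icc _ _) ?_ ?_ fun s hs ↦ ?_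
      · exact fun s hs ↦ (hsol s (lt_of_lt_of_le hS (by linarith [hs.1]))).2.continuousAt.continuousWithinAt
      · exact fun s hs ↦ (hsol s (lt_of_lt_of_le hS (by
          linarith [(interior_subset (s := Icc (t - 1) (t - 1 + 1)) hs).1]))).2.differentiableAt.differentiableWithinAt
      · rw [interior_Icc] at hs
        have hs' : S ≤ s := by linarith [hs.1]
        rw [(hsol s (lt_of_lt_of_le hS hs')).2.deriv]
        exact mul_nonneg (hc.le.trans (hqc s (mem_Ici.2 hs'))) (hpos s (mem_Ici.2 hs')).le
    have hmono' : MonotoneOn (deriv u) (Icc (t - 1) (t - 1 + 1)) := by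
      intro x hx y hy hxy
      rw [hderiv_eq x (lt_of_lt_of_le hS (by linarith [hx.1])),
        hderiv_eq y (lt_of_lt_of_le hS (by linarith [hy.1]))]
      exact hmono hx hy hxy
    have hd' : ∀ τ ∈ Icc (t - 1) (t - 1 + 1), HasDerivAt u (deriv u τ) τ := fun τ hτ ↦ by
      rw [hderiv_eq τ (lt_of_lt_of_le hS (by linarith [hτ.1]))]; exact hd τ hτ
    have h1 : deriv u (t - 1 + 1) ≤ 0 := by
      rw [hderiv_eq _ (lt_of_lt_of_le hS (by linarith))]
      simpa using hder t (mem_Ici.2 htS)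
    have h0 : 0 ≤ u (t - 1 + 1) := by simpa using (hpos t (mem_Ici.2 htS)).le
    have key := abs_deriv_le_of_monotoneOn_of_nonpos hd' hmono' h1 h0
    rw [sub_add_cancel, hderiv_eq t (lt_of_lt_of_le hS htS)] at key
    calc |u' t| ≤ u (t - 1) := key
      _ ≤ u S * Real.exp (-κ * (t - 1 - S)) := hdec (t - 1) (mem_Ici.2 (by linarith))
      _ = u S * Real.exp (κ * (S + 1)) * Real.exp (-(κ * t)) := by
          rw [mul_assoc, ← Real.exp_add]; congr 1; congr 1; ring

end Tail

/-! ## Shooting in a parameter: a bound state at the supremum of the oscillation set -/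

section Shooting

variable {Q v v' : ℝ → ℝ → ℝ} {r₀ r₁ μa μb S c : ℝ}

/-- **A bound state at the supremum of the oscillation set** (shooting in a parameter). Let
`v(μ, ·)`, `μ ∈ [μa, μb]`, solve `v'' = Q(μ, ·) v` on `(r₀, ∞)` (`∂ₜ v = v'`), with
`(μ, t) ↦ v, v'` jointly continuous on `[μa, μb] × (r₀, ∞)`, `v(μ, ·) > 0` on a fixed initial
segment `(r₀, r₁]`, and `Q(μ, t) ≥ c > 0` for `t ≥ S`, uniformly in `μ`. If some `v(μ, ·)` vanishes
somewhere and `v(μb, ·)` vanishes nowhere, then there is `μ₀ ∈ [μa, μb]` — the supremum of the set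
of `μ` for which `v(μ, ·)` has a zero — such that `v(μ₀, ·) > 0` on `(r₀, ∞)`, `∂ₜ v(μ₀, ·) ≤ 0` on
`[S, ∞)`, and `|v(μ₀, t)|, |∂ₜ v(μ₀, t)| ≤ C e^{-√c t}` for `t ≥ S + 1`. (Zeros are simple, hence
sign changes, hence persist under perturbation of `μ`: the oscillation set is open in `[μa, μb]`
and does not contain its supremum `μ₀`; if `∂ₜ v(μ₀, s₀) > 0` at some `s₀ ≥ S`, positivity would
propagate from `s₀` for all nearby `μ` — by convexity beyond `s₀`, by uniform continuity on
`[r₁, s₀]`, by hypothesis on `(r₀, r₁]` — contradicting the approximation of `μ₀` by the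
oscillation set; so `v(μ₀, ·)` is the subordinate solution, `decay_of_deriv_nonpos_tail`.) Hartman,
Ch. XI §6 (disconjugacy, principal solutions) with Ch. V Thm. 2.1 (continuity in parameters); the
ODE form of Shlapentokh-Rothman's `μ₀ = sup 𝒜` (CMP 329 (2014), §4.2, Props. 4.1–4.2).
[cite: Hartman2002, Ch. XI §6 Cor. 6.4; ShlapentokhRothman2014KleinGordon, §4.2 Prop. 4.2] -/
theorem exists_boundState_of_sup_oscillation
    (hQ : ∀ μ ∈ Icc μa μb, ContinuousOn (Q μ) (Ioi r₀))
    (hsol : ∀ μ ∈ Icc μa μb, ∀ t ∈ Ioi r₀,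
      HasDerivAt (v μ) (v' μ t) t ∧ HasDerivAt (v' μ) (Q μ t * v μ t) t)
    (hv : ContinuousOn (fun p : ℝ × ℝ ↦ v p.1 p.2) (Icc μa μb ×ˢ Ioi r₀))
    (hv' : ContinuousOn (fun p : ℝ × ℝ ↦ v' p.1 p.2) (Icc μa μb ×ˢ Ioi r₀))
    (hr₁ : r₀ < r₁) (hpos : ∀ μ ∈ Icc μa μb, ∀ t ∈ Ioc r₀ r₁, 0 < v μ t)
    (hS : r₀ < S) (hc : 0 < c) (hQc : ∀ μ ∈ Icc μa μb, ∀ t ∈ Ici S, c ≤ Q μ t)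
    (hZ : ∃ μ ∈ Icc μa μb, ∃ t ∈ Ioi r₀, v μ t = 0) (hb : ∀ t ∈ Ioi r₀, v μb t ≠ 0) :
    ∃ μ₀ ∈ Icc μa μb, (∀ t ∈ Ioi r₀, 0 < v μ₀ t) ∧ (∀ t ∈ Ici S, v' μ₀ t ≤ 0) ∧
      ∃ C : ℝ, ∀ t : ℝ, S + 1 ≤ t →
        |v μ₀ t| ≤ C * Real.exp (-(Real.sqrt c * t)) ∧
          |v' μ₀ t| ≤ C * Real.exp (-(Real.sqrt c * t)) := by
  -- the oscillation set and its supremum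
  set Z : Set ℝ := {μ ∈ Icc μa μb | ∃ t ∈ Ioi r₀, v μ t = 0} with hZdef
  have hZne : Z.Nonempty := by
    obtain ⟨μ, hμ, t, ht, h0⟩ := hZ
    exact ⟨μ, hμ, t, ht, h0⟩
  have hZbdd : BddAbove Z := ⟨μb, fun μ hμ ↦ hμ.1.2⟩
  set μ₀ : ℝ := sSup Z with hμ₀def
  have hμ₀mem : μ₀ ∈ Icc μa μb := by
    obtain ⟨μ₁, hμ₁⟩ := id hZne
    exact ⟨hμ₁.1.1.trans (le_csSup hZbdd hμ₁), csSup_le hZne fun μ hμ ↦ hμ.1.2⟩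
  -- no solution of the family vanishes identically: `v μ r₁ > 0`
  have hne : ∀ μ ∈ Icc μa μb, v μ r₁ ≠ 0 := fun μ hμ ↦ (hpos μ hμ r₁ ⟨hr₁, le_rfl⟩).ne'
  -- continuity of `μ ↦ v μ t`, `μ ↦ v' μ t` within `[μa, μb]` for fixed `t > r₀`
  have hcv : ∀ t, r₀ < t → ContinuousOn (fun μ ↦ v μ t) (Icc μa μb) := by
    intro t ht
    have h : ContinuousOn (fun μ : ℝ ↦ (μ, t)) (Icc μa μb) := by fun_prop
    exact hv.comp h fun μ hμ ↦ ⟨hμ, ht⟩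
  have hcv' : ∀ t, r₀ < t → ContinuousOn (fun μ ↦ v' μ t) (Icc μa μb) := by
    intro t ht
    have h : ContinuousOn (fun μ : ℝ ↦ (μ, t)) (Icc μa μb) := by fun_prop
    exact hv'.comp h fun μ hμ ↦ ⟨hμ, ht⟩
  -- continuity of `v μ` on `(r₀, ∞)`
  have hcvt : ∀ μ ∈ Icc μa μb, ContinuousOn (v μ) (Ioi r₀) := fun μ hμ t ht ↦
    (hsol μ hμ t ht).1.continuousAt.continuousWithinAt
  -- zeros persist under perturbation of `μ`: `Z` is open in `[μa, μb]`
  have hpersist : ∀ μ ∈ Z, ∃ δ > 0, ∀ μ' ∈ Icc μa μb, |μ' - μ| < δ → μ' ∈ Z := by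
    intro μ hμZ
    obtain ⟨hμ, t, ht, h0⟩ := hμZ
    obtain ⟨tm, tp, htm, htmt, http, -, -, hsign⟩ :=
      exists_sign_change_of_eq_zero (hQ μ hμ) (hsol μ hμ) hr₁ (hne μ hμ) ht h0 zero_lt_one
    have htp : r₀ < tp := lt_trans ht http
    have hprod : ContinuousOn (fun μ' ↦ v μ' tm * v μ' tp) (Icc μa μb) :=
      (hcv tm htm).mul (hcv tp htp)
    have hlt : ∀ᶠ μ' in 𝓝[Icc μa μb] μ, v μ' tm * v μ' tp < 0 :=
      (hprod μ hμ).eventually (eventually_lt_nhds hsign)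
    rw [eventually_nhdsWithin_iff, Metric.eventually_nhds_iff] at hlt
    obtain ⟨δ, hδ, hδp⟩ := hlt
    refine ⟨δ, hδ, fun μ' hμ' hdist ↦ ⟨hμ', ?_⟩⟩
    have hneg : v μ' tm * v μ' tp < 0 := hδp (by rwa [dist_eq_norm, Real.norm_eq_abs]) hμ'
    have hcont : ContinuousOn (v μ') (Icc tm tp) :=
      (hcvt μ' hμ').mono fun s hs ↦ lt_of_lt_of_le htm hs.1
    have hle : tm ≤ tp := (htmt.trans http).le
    rcases mul_neg_iff.1 hneg with ⟨h1, h2⟩ | ⟨h1, h2⟩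
    · obtain ⟨z, hz, hz0⟩ := intermediate_value_Icc' hle hcont ⟨h2.le, h1.le⟩
      exact ⟨z, lt_of_lt_of_le htm hz.1, hz0⟩
    · obtain ⟨z, hz, hz0⟩ := intermediate_value_Icc hle hcont ⟨h1.le, h2.le⟩
      exact ⟨z, lt_of_lt_of_le htm hz.1, hz0⟩
  -- hence `μ₀ ∉ Z`
  have hμ₀Z : μ₀ ∉ Z := by
    intro hZ0
    have hlt : μ₀ < μb := by
      rcases eq_or_lt_of_le hμ₀mem.2 with h | h
      · exfalso
        obtain ⟨-, t, ht, h0⟩ := hZ0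
        exact hb t ht (by rw [← h]; exact h0)
      · exact h
    obtain ⟨δ, hδ, hδp⟩ := hpersist μ₀ hZ0
    have hμ'mem : min μb (μ₀ + δ / 2) ∈ Icc μa μb :=
      ⟨le_min (hμ₀mem.1.trans hμ₀mem.2) (by linarith [hμ₀mem.1]), min_le_left _ _⟩
    have hμ'gt : μ₀ < min μb (μ₀ + δ / 2) := lt_min hlt (by linarith)
    have hμ'Z : min μb (μ₀ + δ / 2) ∈ Z := by
      refine hδp _ hμ'mem ?_
      rw [abs_of_pos (sub_pos.2 hμ'gt)]
      have := min_le_right μb (μ₀ + δ / 2)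
      linarith
    exact absurd (le_csSup hZbdd hμ'Z) (not_le.2 hμ'gt)
  -- positivity of `v μ₀` on `(r₀, ∞)`
  have hpos₀ : ∀ t ∈ Ioi r₀, 0 < v μ₀ t := by
    intro t ht
    by_contra hle
    push Not at hle
    rcases le_or_gt t r₁ with h | h
    · exact absurd (hpos μ₀ hμ₀mem t ⟨ht, h⟩) (not_lt.2 hle)
    · have hcont : ContinuousOn (v μ₀) (Icc r₁ t) :=
        (hcvt μ₀ hμ₀mem).mono fun s hs ↦ lt_of_lt_of_le hr₁ hs.1
      obtain ⟨z, hz, hz0⟩ := intermediate_value_Icc' h.le hcont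
        ⟨hle, (hpos μ₀ hμ₀mem r₁ ⟨hr₁, le_rfl⟩).le⟩
      exact hμ₀Z ⟨hμ₀mem, z, lt_of_lt_of_le hr₁ hz.1, hz0⟩
  -- approximation of `μ₀` from below by the oscillation set
  have happrox : ∀ δ > 0, ∃ μ ∈ Z, μ₀ - δ < μ ∧ μ < μ₀ := by
    intro δ hδ
    obtain ⟨μ, hμZ, hμ⟩ := exists_lt_of_lt_csSup hZne (show μ₀ - δ < sSup Z by rw [← hμ₀def]; linarith)
    exact ⟨μ, hμZ, hμ, lt_of_le_of_ne (le_csSup hZbdd hμZ) fun h ↦ hμ₀Z (h ▸ hμZ)⟩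
  -- the derivative of `v μ₀` is `≤ 0` on `[S, ∞)`
  have hder : ∀ s ∈ Ici S, v' μ₀ s ≤ 0 := by
    by_contra hA
    push Not at hA
    obtain ⟨s₀, hs₀, hds₀⟩ := hA
    have hs₀S : S ≤ s₀ := mem_Ici.1 hs₀
    have hs₀r : r₀ < s₀ := lt_of_lt_of_le hS hs₀S
    have hvs₀ : 0 < v μ₀ s₀ := hpos₀ s₀ hs₀r
    -- (a) data at `s₀` stay positive for `μ` near `μ₀`
    have h12 : ∀ᶠ μ in 𝓝[Icc μa μb] μ₀, 0 < v μ s₀ ∧ 0 < v' μ s₀ :=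
      ((hcv s₀ hs₀r μ₀ hμ₀mem).eventually (eventually_gt_nhds hvs₀)).and
        ((hcv' s₀ hs₀r μ₀ hμ₀mem).eventually (eventually_gt_nhds hds₀))
    rw [eventually_nhdsWithin_iff, Metric.eventually_nhds_iff] at h12
    obtain ⟨δ₁, hδ₁, hδ₁p⟩ := h12
    -- (b) uniform closeness to `v μ₀ > 0` on the compact middle part `[r₁, max r₁ s₀]`
    set s₁ : ℝ := max r₁ s₀ with hs₁
    have hK : IsCompact (Icc μa μb ×ˢ Icc r₁ s₁) := isCompact_Icc.prod isCompact_Icc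
    have hKsub : Icc μa μb ×ˢ Icc r₁ s₁ ⊆ Icc μa μb ×ˢ Ioi r₀ :=
      prod_mono le_rfl fun t ht ↦ lt_of_lt_of_le hr₁ ht.1
    have hUC : UniformContinuousOn (fun p : ℝ × ℝ ↦ v p.1 p.2) (Icc μa μb ×ˢ Icc r₁ s₁) :=
      hK.uniformContinuousOn_of_continuous (hv.mono hKsub)
    obtain ⟨z₀, hz₀, hz₀min⟩ := (isCompact_Icc (a := r₁) (b := s₁)).exists_isMinOn
      (nonempty_Icc.2 (le_max_left _ _)) ((hcvt μ₀ hμ₀mem).mono fun t ht ↦ lt_of_lt_of_le hr₁ ht.1)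
    set m : ℝ := v μ₀ z₀ with hm
    have hm0 : 0 < m := hpos₀ z₀ (lt_of_lt_of_le hr₁ hz₀.1)
    obtain ⟨δ₂, hδ₂, hδ₂p⟩ := Metric.uniformContinuousOn_iff.1 hUC m hm0
    have hmid : ∀ μ ∈ Icc μa μb, |μ - μ₀| < δ₂ → ∀ t ∈ Icc r₁ s₁, 0 < v μ t := by
      intro μ hμ hdist t ht
      have hd : dist ((μ, t) : ℝ × ℝ) (μ₀, t) < δ₂ := by
        rw [Prod.dist_eq, dist_self, dist_eq_norm, Real.norm_eq_abs, max_eq_left (abs_nonneg _)]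
        exact hdist
      have h := hδ₂p (μ, t) ⟨hμ, ht⟩ (μ₀, t) ⟨hμ₀mem, ht⟩ hd
      rw [Real.dist_eq] at h
      have hmin : m ≤ v μ₀ t := hz₀min ht
      have := neg_abs_le (v μ t - v μ₀ t)
      simp only at h
      linarith [abs_sub_lt_iff.1 h]
    -- (c) a `μ ∈ Z` this close to `μ₀` has no zero: contradiction
    obtain ⟨μ, hμZ, hμlo, hμhi⟩ := happrox (min δ₁ δ₂) (lt_min hδ₁ hδ₂)
    have hμ : μ ∈ Icc μa μb := hμZ.1
    have hdist : |μ - μ₀| < min δ₁ δ₂ := by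
      rw [abs_sub_lt_iff]; constructor <;> linarith
    obtain ⟨hv0, hd0⟩ := hδ₁p (by rw [dist_eq_norm, Real.norm_eq_abs]; exact hdist.trans_le (min_le_left _ _)) hμ
    have hright : ∀ t ∈ Ici s₀, 0 < v μ t :=
      pos_of_nonneg_coeff_Ici (hQ μ hμ) (hsol μ hμ) hs₀r
        (fun t ht ↦ hc.le.trans (hQc μ hμ t (mem_Ici.2 (hs₀S.trans (mem_Ici.1 ht))))) hv0 hd0.le
    obtain ⟨-, t, ht, h0⟩ := hμZ
    have hvt : 0 < v μ t := by
      rcases le_or_gt t r₁ with h | h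
      · exact hpos μ hμ t ⟨ht, h⟩
      · rcases le_or_gt t s₁ with h' | h'
        · exact hmid μ hμ (hdist.trans_le (min_le_right _ _)) t ⟨h.le, h'⟩
        · exact hright t (mem_Ici.2 ((le_max_right _ _).trans h'.le))
    exact absurd h0 hvt.ne'
  -- the subordinate tail
  obtain ⟨C, hC⟩ := decay_of_deriv_nonpos_tail (hQ μ₀ hμ₀mem) (hsol μ₀ hμ₀mem) hS hc
    (hQc μ₀ hμ₀mem) (fun t ht ↦ hpos₀ t (lt_of_lt_of_le hS (mem_Ici.1 ht))) hder
  exact ⟨μ₀, hμ₀mem, hpos₀, hder, C, hC⟩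

end Shooting

/-! ## Positivity from a singular left endpoint -/

section Singular

variable {P G u u' : ℝ → ℝ} {r₀ : ℝ}

/-- **Positivity propagation from a singular left endpoint.** Let `(P u')' = G u` on `(r₀, ∞)`
in the sense that `u` has derivative `u'` and the flux `P u'` has derivative `G u`, with `P > 0`
and `G ≥ 0` there. If the flux tends to `0` at `r₀⁺` and `u > 0` on some initial segment
`(r₀, r₁]`, then `u > 0` on all of `(r₀, ∞)` (before a first zero `z₀` the flux is nondecreasing
from its limit `0`, so `u` is nondecreasing and cannot come down to `0`). This is the form of the
maximum principle used for the radial equation `Δ (Δ R')' = V R`, `V ≥ 0`, at the horizon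
`Δ(r₊) = 0` (Shlapentokh-Rothman, CMP 329 (2014), §3.2–§3.3).
[cite: ShlapentokhRothman2014KleinGordon, §3.2; Hartman2002, Ch. XI Cor. 6.4 (proof)] -/
theorem pos_of_flux_tendsto_zero
    (hsol : ∀ t ∈ Ioi r₀, HasDerivAt u (u' t) t ∧ HasDerivAt (fun s ↦ P s * u' s) (G t * u t) t)
    (hP : ∀ t ∈ Ioi r₀, 0 < P t) (hG : ∀ t ∈ Ioi r₀, 0 ≤ G t)
    (hflux : Tendsto (fun s ↦ P s * u' s) (𝓝[>] r₀) (𝓝 0)) {r₁ : ℝ} (hr₁ : r₀ < r₁)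
    (hinit : ∀ t ∈ Ioc r₀ r₁, 0 < u t) : ∀ t ∈ Ioi r₀, 0 < u t := by
  have hcont : ContinuousOn u (Ioi r₀) := fun t ht ↦ (hsol t ht).1.continuousAt.continuousWithinAt
  by_contra hcon
  push Not at hcon
  obtain ⟨z, hz, huz⟩ := hcon
  have hzr₁ : r₁ < z := by
    by_contra h
    push Not at h
    exact absurd (hinit z ⟨hz, h⟩) (not_lt.2 huz)
  -- the first time `u ≤ 0` in `[r₁, z]`
  set Zs : Set ℝ := {t ∈ Icc r₁ z | u t ≤ 0} with hZs
  have hZne : Zs.Nonempty := ⟨z, ⟨hzr₁.le, le_rfl⟩, huz⟩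
  have hZbdd : BddBelow Zs := ⟨r₁, fun t ht ↦ ht.1.1⟩
  have hZclosed : IsClosed Zs := by
    have hc : ContinuousOn u (Icc r₁ z) := hcont.mono fun t ht ↦ lt_of_lt_of_le hr₁ ht.1
    have : Zs = Icc r₁ z ∩ u ⁻¹' Iic 0 := by ext t; simp [hZs]
    rw [this]
    exact hc.preimage_isClosed_of_isClosed isClosed_Icc isClosed_Iic
  set z₀ := sInf Zs with hz₀
  have hz₀Z : z₀ ∈ Zs := hZclosed.csInf_mem hZne hZbdd
  have hz₀r₁ : r₁ < z₀ := by
    rcases eq_or_lt_of_le hz₀Z.1.1 with h | h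
    · exact absurd (hinit r₁ ⟨hr₁, le_rfl⟩) (not_lt.2 (h ▸ hz₀Z.2))
    · exact h
  have hz₀r : r₀ < z₀ := hr₁.trans hz₀r₁
  -- `u > 0` on `(r₀, z₀)`
  have hposlt : ∀ t, r₀ < t → t < z₀ → 0 < u t := by
    intro t ht htz
    rcases le_or_gt t r₁ with h | h
    · exact hinit t ⟨ht, h⟩
    · by_contra hle
      push Not at hle
      have htZ : t ∈ Zs := ⟨⟨h.le, htz.le.trans hz₀Z.1.2⟩, hle⟩
      exact absurd (csInf_le hZbdd htZ) (not_le.2 htz)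
  -- the flux is nondecreasing on `(r₀, z₀)` (as `G u ≥ 0` there), hence `≥ 0` by the limit at `r₀`
  have hflux_nonneg : ∀ t, r₀ < t → t < z₀ → 0 ≤ P t * u' t := by
    intro t ht htz
    have hmono : MonotoneOn (fun s ↦ P s * u' s) (Ioc r₀ t) := by
      refine monotoneOn_of_deriv_nonneg (convex_Ioc r₀ t)
        (fun s hs ↦ (hsol s hs.1).2.continuousAt.continuousWithinAt)
        (fun s hs ↦ (hsol s (interior_subset (s := Ioc r₀ t) hs).1).2.differentiableAt.differentiableWithinAt)
        fun s hs ↦ ?_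
      rw [interior_Ioc] at hs
      rw [(hsol s hs.1).2.deriv]
      exact mul_nonneg (hG s hs.1) (hposlt s hs.1 (hs.2.trans htz)).le
    -- `P t u' t ≥ P s u' s → 0` as `s → r₀⁺`
    have hev : ∀ᶠ s in 𝓝[>] r₀, P s * u' s ≤ P t * u' t := by
      have hmem : Ioo r₀ t ∈ 𝓝[>] r₀ := Ioo_mem_nhdsGT ht
      filter_upwards [hmem] with s hs
      exact hmono ⟨hs.1, hs.2.le⟩ ⟨ht, le_rfl⟩ hs.2.le
    exact le_of_tendsto hflux hev
  -- hence `u` is nondecreasing on `(r₀, z₀]`, contradicting `u z₀ ≤ 0 < u`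
  have hmono_u : MonotoneOn u (Icc ((r₁ + z₀) / 2) z₀) := by
    have hlo : r₀ < (r₁ + z₀) / 2 := by linarith
    refine monotoneOn_of_deriv_nonneg (convex_Icc _ _)
      (hcont.mono fun s hs ↦ lt_of_lt_of_le hlo hs.1)
      (fun s hs ↦ (hsol s (lt_of_lt_of_le hlo
        (interior_subset (s := Icc ((r₁ + z₀) / 2) z₀) hs).1)).1.differentiableAt.differentiableWithinAt)
      fun s hs ↦ ?_
    rw [interior_Icc] at hs
    have hsr : r₀ < s := hlo.trans hs.1
    rw [(hsol s hsr).1.deriv]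
    have h := hflux_nonneg s hsr hs.2
    have hPs := hP s hsr
    by_contra hneg
    push Not at hneg
    have : P s * u' s < 0 := mul_neg_of_pos_of_neg hPs hneg
    linarith
  have hmid : r₀ < (r₁ + z₀) / 2 := by linarith
  have h1 : u ((r₁ + z₀) / 2) ≤ u z₀ :=
    hmono_u (left_mem_Icc.2 (by linarith)) (right_mem_Icc.2 (by linarith)) (by linarith)
  have h2 : 0 < u ((r₁ + z₀) / 2) := hposlt _ hmid (by linarith)
  linarith [hz₀Z.2]

end Singular

end Literature.Analysis.ODE
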